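import Literature.Probability.RandomPlanarGeometry.SAWStripTM
import Mathlib.Data.List.Chain
import Mathlib.Data.List.Nodup
import Mathlib.Data.Finset.Basic
import Mathlib.Data.Sym.Sym2
import Mathlib.Logic.Relation
import HarnessLib

/-!
# Strand families: the ghost state of the strip transfer matrix (soundness, part 1)

Topic `Literature/Probability/RandomPlanarGeometry` (soundness of `SAWStripTM.lean`, part 1). The
signature automaton of `SAWStripTM.lean` only remembers the codes of the frontier cells. To prove
that every accepted trace is a self-avoiding walk we run, in the proofs only, an ENRICHED automaton
whose state also carries the partial walk below the frontier as a **strand family**: a list of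
vertex-disjoint simple paths ("strands") of cells, each a chain for the adjacency relation `A`,
whose ends are frontier cells or the two virtual vertices `vsrc`/`vsnk` (Knuth's `SIMPATH`
invariant, TAOCP 4A §7.1.4). This file is the abstract bookkeeping, for an arbitrary symmetric
adjacency `A`:

* `XCell` (grid cells and the two virtual vertices), `WF A S` (well-formed strand family),
  `cells S`, `pairs S` (the edges, as `Sym2`), `endPairs S` (ordered pairs of ends of a strand);
* the single primitive **`merge S x y`** (join the strand ending at `x` to the strand ending at
  `y` by the edge `x—y`; adding a fresh vertex first as a singleton strand covers "extend" and
  "new strand") and its specification `merge_spec`: well-formedness is kept, `cells` unchanged,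
  `pairs` gains `s(x, y)`, and the end pairs of the two strands are replaced by the pair of their
  far ends.

## References

* D. E. Knuth, *The Art of Computer Programming*, Vol. 4A (2011), §7.1.4, `SIMPATH`.
* I. Jensen, J. Phys. A 37 (2004) 11521–11529, §2.1 (transfer matrices for bridges).
-/

namespace Literature.Probability.RandomPlanarGeometry.SAW

namespace StripTM

/-! ### Cells, strands, families -/

/-- A vertex of the enriched configuration: a grid cell `(c, r)` or one of the two virtual
vertices (source = the start of the bridge at `x = 0`, sink = "end of the bridge"). [folklore] -/
inductive XCell
  | cell (c r : ℕ)
  | vsrc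
  | vsnk
  deriving DecidableEq, Repr

/-- Real (grid) cells. [folklore] -/
def XCell.IsReal : XCell → Prop
  | .cell _ _ => True
  | _ => False

/-- Realness is decidable. [folklore] -/
instance (x : XCell) : Decidable x.IsReal := by
  cases x <;> simp only [XCell.IsReal] <;> infer_instance

/-- `x` is an end (first or last element) of the strand `π`. [folklore] -/
def isEnd (x : XCell) (π : List XCell) : Bool := (π.head? == some x) || (π.getLast? == some x)

/-- `isEnd` unfolded. [folklore] -/
theorem isEnd_iff {x : XCell} {π : List XCell} : isEnd x π = true ↔ π.head? = some x ∨ π.getLast? = some x := by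
  simp [isEnd]

/-- An end is a member. [folklore] -/
theorem mem_of_isEnd {x : XCell} {π : List XCell} (h : isEnd x π = true) : x ∈ π := by
  rcases isEnd_iff.1 h with h | h
  · exact List.mem_of_mem_head? h
  · exact List.mem_of_getLast? h

/-- `isEnd` is invariant under reversal. [folklore] -/
@[simp] theorem isEnd_reverse (x : XCell) (π : List XCell) : isEnd x π.reverse = isEnd x π := by
  rw [Bool.eq_iff_iff, isEnd_iff, isEnd_iff, List.head?_reverse, List.getLast?_reverse, or_comm]

/-- Orient the strand `π` so that it ENDS at `x` (if `x` is an end of `π`). [folklore] -/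
def orientTo (π : List XCell) (x : XCell) : List XCell := if π.getLast? = some x then π else π.reverse

/-- `orientTo π x` ends at `x`. [folklore] -/
theorem getLast?_orientTo {π : List XCell} {x : XCell} (h : isEnd x π = true) :
    (orientTo π x).getLast? = some x := by
  unfold orientTo; split_ifs with h'
  · exact h'
  · rw [List.getLast?_reverse]; rcases isEnd_iff.1 h with h | h; exact h; exact absurd h h'

/-- `orientTo` is `π` or its reverse. [folklore] -/
theorem orientTo_eq_or (π : List XCell) (x : XCell) : orientTo π x = π ∨ orientTo π x = π.reverse := by
  unfold orientTo; split_ifs; exact Or.inl rfl; exact Or.inr rfl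

/-- Membership in `orientTo`. [folklore] -/
@[simp] theorem mem_orientTo {π : List XCell} {x z : XCell} : z ∈ orientTo π x ↔ z ∈ π := by
  rcases orientTo_eq_or π x with h | h <;> rw [h]; rw [List.mem_reverse]

/-- The cells of a family. [folklore] -/
def cells (S : List (List XCell)) : Finset XCell := S.flatten.toFinset

/-- Membership in `cells`. [folklore] -/
theorem mem_cells {S : List (List XCell)} {x : XCell} : x ∈ cells S ↔ ∃ π ∈ S, x ∈ π := by
  simp [cells, List.mem_flatten]

/-- The consecutive pairs (edges) of a strand, as unordered pairs. [folklore] -/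
def cpairs : List XCell → List (Sym2 XCell)
  | a :: b :: t => s(a, b) :: cpairs (b :: t)
  | _ => []

/-- The edges of a family. [folklore] -/
def pairs (S : List (List XCell)) : Finset (Sym2 XCell) := (S.flatMap cpairs).toFinset

/-- Membership in `pairs`. [folklore] -/
theorem mem_pairs {S : List (List XCell)} {p : Sym2 XCell} : p ∈ pairs S ↔ ∃ π ∈ S, p ∈ cpairs π := by
  simp [pairs, List.mem_flatMap]

/-- The ordered pairs (first, last), (last, first) of a strand. [folklore] -/
def epairs (π : List XCell) : List (XCell × XCell) :=
  match π.head?, π.getLast? with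
  | some a, some b => [(a, b), (b, a)]
  | _, _ => []

/-- Membership in `epairs`. [folklore] -/
theorem mem_epairs {π : List XCell} {a b : XCell} :
    (a, b) ∈ epairs π ↔ (π.head? = some a ∧ π.getLast? = some b) ∨ (π.head? = some b ∧ π.getLast? = some a) := by
  unfold epairs
  cases hh : π.head? with
  | none => simp
  | some u =>
    cases hl : π.getLast? with
    | none => simp
    | some v =>
      simp only [List.mem_cons, Prod.mk.injEq, List.not_mem_nil, or_false, Option.some.injEq]
      constructor
      · rintro (⟨rfl, rfl⟩ | ⟨rfl, rfl⟩); exact Or.inl ⟨rfl, rfl⟩; exact Or.inr ⟨rfl, rfl⟩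
      · rintro (⟨rfl, rfl⟩ | ⟨rfl, rfl⟩); exact Or.inl ⟨rfl, rfl⟩; exact Or.inr ⟨rfl, rfl⟩

/-- `epairs` is invariant under reversal (as a set). [folklore] -/
theorem mem_epairs_reverse {π : List XCell} {a b : XCell} : (a, b) ∈ epairs π.reverse ↔ (a, b) ∈ epairs π := by
  rw [mem_epairs, mem_epairs, List.head?_reverse, List.getLast?_reverse]; tauto

/-- The end pairs of a family. [folklore] -/
def endPairs (S : List (List XCell)) : Finset (XCell × XCell) := (S.flatMap epairs).toFinset

/-- Membership in `endPairs`. [folklore] -/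
theorem mem_endPairs {S : List (List XCell)} {a b : XCell} :
    (a, b) ∈ endPairs S ↔ ∃ π ∈ S, (a, b) ∈ epairs π := by
  simp [endPairs, List.mem_flatMap]

/-- The first component of an end pair is an end. [folklore] -/
theorem isEnd_of_mem_epairs {π : List XCell} {a b : XCell} (h : (a, b) ∈ epairs π) : isEnd a π = true := by
  rw [isEnd_iff]; rcases mem_epairs.1 h with ⟨h1, -⟩ | ⟨-, h2⟩; exact Or.inl h1; exact Or.inr h2

/-- An end gives an end pair. [folklore] -/
theorem exists_mem_epairs_of_isEnd {π : List XCell} {a : XCell} (h : isEnd a π = true) :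
    ∃ b, (a, b) ∈ epairs π := by
  have hne : π ≠ [] := List.ne_nil_of_mem (mem_of_isEnd h)
  rcases isEnd_iff.1 h with h1 | h2
  · exact ⟨π.getLast hne, mem_epairs.2 (Or.inl ⟨h1, List.getLast?_eq_some_getLast hne⟩)⟩
  · exact ⟨π.head hne, mem_epairs.2 (Or.inr ⟨List.head?_eq_some_head hne, h2⟩)⟩

/-! ### Consecutive pairs -/

/-- Members of consecutive pairs are members of the strand. [folklore] -/
theorem mem_of_mem_cpairs {π : List XCell} {a b : XCell} (h : s(a, b) ∈ cpairs π) : a ∈ π ∧ b ∈ π := by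
  induction π with
  | nil => simp [cpairs] at h
  | cons u t ih =>
    cases t with
    | nil => simp [cpairs] at h
    | cons v t' =>
      simp only [cpairs, List.mem_cons, Sym2.eq_iff] at h
      rcases h with (⟨rfl, rfl⟩ | ⟨rfl, rfl⟩) | h
      · simp
      · simp
      · have := ih h; exact ⟨List.mem_cons_of_mem _ this.1, List.mem_cons_of_mem _ this.2⟩

/-- `cpairs` of an append with non-empty pieces. [folklore] -/
theorem cpairs_append {l₁ l₂ : List XCell} {a b : XCell} (h₁ : l₁.getLast? = some a) (h₂ : l₂.head? = some b) :
    cpairs (l₁ ++ l₂) = cpairs l₁ ++ s(a, b) :: cpairs l₂ := by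
  induction l₁ with
  | nil => simp at h₁
  | cons u t ih =>
    cases t with
    | nil =>
      simp only [List.getLast?_singleton, Option.some.injEq] at h₁
      subst h₁
      cases l₂ with
      | nil => simp at h₂
      | cons v t' => simp only [List.head?_cons, Option.some.injEq] at h₂; subst h₂; rfl
    | cons v t' =>
      have h₁' : (v :: t').getLast? = some a := by
        rw [List.getLast?_cons_cons] at h₁; exact h₁
      have := ih h₁'
      simp only [List.cons_append, cpairs] at this ⊢
      rw [this]

/-- Membership in `cpairs` is invariant under reversal. [folklore] -/
theorem mem_cpairs_reverse {π : List XCell} {p : Sym2 XCell} : p ∈ cpairs π.reverse ↔ p ∈ cpairs π := by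
  suffices key : ∀ (π : List XCell) (p : Sym2 XCell), p ∈ cpairs π → p ∈ cpairs π.reverse by
    refine ⟨fun h => ?_, key π p⟩
    have := key _ _ h; rwa [List.reverse_reverse] at this
  intro π
  induction π with
  | nil => simp [cpairs]
  | cons u t ih =>
    intro p hp
    cases t with
    | nil => simp [cpairs] at hp
    | cons v t' =>
      simp only [cpairs, List.mem_cons] at hp
      rw [List.reverse_cons, cpairs_append (a := v) (b := u) (by simp) rfl]
      rcases hp with rfl | hp
      · rw [List.mem_append, List.mem_cons, Sym2.eq_swap]; exact Or.inr (Or.inl rfl)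
      · exact List.mem_append_left _ (ih p hp)

/-- `cpairs` of a singleton. [folklore] -/
@[simp] theorem cpairs_singleton (a : XCell) : cpairs [a] = [] := rfl

/-- Consecutive pairs of a `Nodup` strand join distinct cells. [folklore] -/
theorem ne_of_mem_cpairs {π : List XCell} (hπ : π.Nodup) {a b : XCell} (h : s(a, b) ∈ cpairs π) : a ≠ b := by
  induction π with
  | nil => simp [cpairs] at h
  | cons u t ih =>
    cases t with
    | nil => simp [cpairs] at h
    | cons v t' =>
      simp only [cpairs, List.mem_cons, Sym2.eq_iff] at h
      have huv : u ≠ v := by intro e; subst e; simp at hπ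
      rcases h with (⟨rfl, rfl⟩ | ⟨rfl, rfl⟩) | h
      · exact huv
      · exact huv.symm
      · exact ih (List.Nodup.of_cons hπ) h

/-! ### Well-formed families -/

variable (A : XCell → XCell → Prop)

/-- **Well-formed strand family**: non-empty duplicate-free chains for `A`, pairwise disjoint,
with the virtual vertices only at strand ends. [cite: Jensen2004SAWLowerBounds, §2.1] -/
structure WF (S : List (List XCell)) : Prop where
  /-- strands are non-empty -/
  ne_nil : ∀ π ∈ S, π ≠ []
  /-- strands are simple -/
  nodup : ∀ π ∈ S, π.Nodup
  /-- strands are chains of adjacent vertices -/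
  chain : ∀ π ∈ S, π.IsChain A
  /-- strands are disjoint -/
  disj : S.Pairwise fun π π' => ∀ x ∈ π, x ∉ π'
  /-- interior vertices are real -/
  virt : ∀ π ∈ S, ∀ x ∈ π, isEnd x π = false → x.IsReal

variable {A}

/-- The empty family is well formed. [folklore] -/
theorem WF.nil : WF A [] := ⟨by simp, by simp, by simp, List.Pairwise.nil, by simp⟩

/-- In a well-formed family a cell lies in at most one strand. [folklore] -/
theorem WF.eq_of_mem {S : List (List XCell)} (h : WF A S) {π π' : List XCell} (hπ : π ∈ S) (hπ' : π' ∈ S)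
    {x : XCell} (hx : x ∈ π) (hx' : x ∈ π') : π = π' := by
  by_contra hne
  haveI : Std.Symm fun (π π' : List XCell) => ∀ x ∈ π, x ∉ π' :=
    ⟨fun a b hab x hxb hxa => hab x hxa hxb⟩
  exact h.disj.forall hπ hπ' hne x hx hx'

/-- Uniqueness of the mate: `(a, b), (a, b') ∈ endPairs S ⇒ b = b'`. [folklore] -/
theorem WF.endPairs_unique {S : List (List XCell)} (h : WF A S) {a b b' : XCell}
    (hb : (a, b) ∈ endPairs S) (hb' : (a, b') ∈ endPairs S) : b = b' := by
  obtain ⟨π, hπ, hp⟩ := mem_endPairs.1 hb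
  obtain ⟨π', hπ', hp'⟩ := mem_endPairs.1 hb'
  have e : π = π' := h.eq_of_mem hπ hπ' (mem_of_isEnd (isEnd_of_mem_epairs hp))
    (mem_of_isEnd (isEnd_of_mem_epairs hp'))
  subst e
  have hnd := h.nodup π hπ
  rcases mem_epairs.1 hp with ⟨h1, h2⟩ | ⟨h1, h2⟩ <;> rcases mem_epairs.1 hp' with ⟨h1', h2'⟩ | ⟨h1', h2'⟩
  · rw [h2] at h2'; exact Option.some.inj h2'
  · -- a = head = last: then b = last = a and b' = head = a
    rw [h1] at h1'; rw [h2] at h2'; cases h1'; cases h2'; rfl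
  · rw [h1] at h1'; rw [h2] at h2'; cases h1'; cases h2'; rfl
  · rw [h1] at h1'; exact Option.some.inj h1'

/-- Adding a fresh vertex as a singleton strand keeps well-formedness. [folklore] -/
theorem WF.add_singleton {S : List (List XCell)} (h : WF A S) {z : XCell} (hz : z ∉ cells S) :
    WF A (S ++ [[z]]) := by
  refine ⟨?_, ?_, ?_, ?_, ?_⟩
  · intro π hπ; rw [List.mem_append, List.mem_singleton] at hπ
    rcases hπ with hπ | rfl; exact h.ne_nil π hπ; simp
  · intro π hπ; rw [List.mem_append, List.mem_singleton] at hπ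
    rcases hπ with hπ | rfl; exact h.nodup π hπ; simp
  · intro π hπ; rw [List.mem_append, List.mem_singleton] at hπ
    rcases hπ with hπ | rfl; exact h.chain π hπ; simp
  · rw [List.pairwise_append]
    refine ⟨h.disj, List.pairwise_singleton _ _, fun π hπ π' hπ' x hx hx' => ?_⟩
    rw [List.mem_singleton] at hπ'; subst hπ'
    rw [List.mem_singleton] at hx'; subst hx'
    exact hz (mem_cells.2 ⟨π, hπ, hx⟩)
  · intro π hπ x hx hne; rw [List.mem_append, List.mem_singleton] at hπ
    rcases hπ with hπ | rfl; exact h.virt π hπ x hx hne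
    rw [List.mem_singleton] at hx; subst hx; simp [isEnd] at hne

/-- Cells after adding a singleton. [folklore] -/
theorem cells_add_singleton (S : List (List XCell)) (z : XCell) : cells (S ++ [[z]]) = insert z (cells S) := by
  ext x; simp [cells]

/-- Pairs after adding a singleton. [folklore] -/
theorem pairs_add_singleton (S : List (List XCell)) (z : XCell) : pairs (S ++ [[z]]) = pairs S := by
  ext p; simp [pairs]

/-- End pairs after adding a singleton. [folklore] -/
theorem endPairs_add_singleton (S : List (List XCell)) (z : XCell) :
    endPairs (S ++ [[z]]) = insert (z, z) (endPairs S) := by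
  ext ⟨a, b⟩
  simp only [mem_endPairs, List.mem_append, List.mem_singleton, Finset.mem_insert, Prod.mk.injEq]
  constructor
  · rintro ⟨π, hπ | rfl, hp⟩
    · exact Or.inr ⟨π, hπ, hp⟩
    · rw [mem_epairs] at hp; simp only [List.head?_cons, List.getLast?_singleton, Option.some.injEq] at hp
      rcases hp with ⟨rfl, rfl⟩ | ⟨rfl, rfl⟩ <;> exact Or.inl ⟨rfl, rfl⟩
  · rintro (⟨ha, hb⟩ | ⟨π, hπ, hp⟩)
    · rw [ha, hb]; exact ⟨[z], Or.inr rfl, mem_epairs.2 (Or.inl ⟨rfl, rfl⟩)⟩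
    · exact ⟨π, Or.inl hπ, hp⟩

end StripTM

end Literature.Probability.RandomPlanarGeometry.SAW
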